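import Mathlib.Analysis.SpecialFunctions.Pow.Real
import Mathlib.Algebra.Order.BigOperators.Group.Finset
import Mathlib.Data.Int.Interval
import Literature.MathematicalPhysics.QuantumLattice.RunningCouplingFlow
import HarnessLib

/-!
# BGM 2006 §3: smoothness of the effective dispersion relation and the flow of the quartic couplings
# (Theorem 3.1, (3.1)–(3.8a), Lemma 3.1, (3.65)–(3.77)) — statements, typed

G. Benfatto, A. Giuliani, V. Mastropietro, *Fermi liquid behavior in the 2D Hubbard model at low
temperatures*, Ann. Henri Poincaré **7** (2006) 809–898 = arXiv:cond-mat/0507686, §3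
[cite: BenfattoGiulianiMastropietro2006, §3]. Typer wave gate-hubbard-kl (D-0069 (2)), seat t2, file F2b of
HOME/DAG.tsv; rows BGM06.S3.1, BGM06.T3.1 (FACT-LIST F-009), BGM06.L3.1 (TREE), BGM06.S3.2 and the locator
aids E3.2, E3.14, R3.1, E3.65, E3.67, E3.70, E3.74. LOCATORS `pNNNN:Ln` are chunk:line of the `lit read`
render of the arXiv TeX (not printed pages); equation numbers are the TeX labels `\Eq(…)`.

## What §3 says (architecture)

The multiscale integration of §2 is well defined under two inductive assumptions: the smallness /
smoothness bounds (2.36) on the increments `E_h − E_{h−1}` of the effective dispersion relation, and the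
smallness (2.71a) of the sector-modified running coupling functions `λ̃_{h,Ω}`. §3.1 proves (2.36) at
scale `h` from the assumptions at the higher scales (Theorem 3.1, via the tree expansion (3.4) of the
sectorised increment `β²_{h,ω̄}` (3.1), the improved two-leg bounds (3.6)–(3.7), the loop-contracted vertex
bound (3.8) and the isotropic four-sector counting Lemma 3.1); §3.2 proves (2.71a)/(2.71b) and (3.8) from
(2.36) at the higher scales by the beta-function equation (3.66) and the conditional increment bound
(3.69) ⟹ `|β⁴| ≤ c|U|²`, summed over `|h| ≲ c₀/|U|` scales (3.70) — this is where `β⁻¹ ≥ e^{−a/|U|}`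
(the device `U₀|h_β| = c₀`) enters (DECOMP App. D: U1 = (3.2), U4 = (3.65)/(3.70), U5 = (3.74)–(3.77)).

## Typing level (read this first)

The objects of §3 (trees `τ ∈ 𝒯_{h,n}` with labels, sectorised kernels, `β²_{h,ω̄}`, `λ̃_{j,Ω₄}`, `β⁴_{j',Ω₄}`)
are NOT constructed here; following the tree's `RunningCouplingFlow` ((3.66)–(3.70) as arithmetic on
scale-indexed sequences) every statement is typed as a `Prop`-valued PREDICATE, with the printed
constants and exponents explicit, on SCALE-INDEXED NUMERICAL DATA (`ScaleData`: the sup-norms and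
weighted `L¹` norms that the displayed inequalities bound, each field's docstring saying which printed
quantity it stands for) and on the COMBINATORIAL PROFILE of a labelled tree (`LabelledTree`: `n`, `h`,
`|P_{v₀}|`, and `|P_v|`, `s_v`, `h_v`, `h_{v'}` over the relevant vertices). Nothing is asserted: a
consumer instantiates `ScaleData` with the BGM objects of the 2D Hubbard model and ASSUMES the FACT
predicate (`Theorem31`) as a hypothesis; the DEF/EQ predicates (`Hyp236`, `Bound365`, `Bound36`, …) are
the vocabulary in which hypotheses and conclusions are stated. Constants are PARAMETERS (no inner `∃`),
so that Theorem 3.1 and the §3.2 bounds can be taken at the same constants, as the induction requires.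
This file is STATEMENT-ONLY (definitions and predicates). PROVED consequences — a check on the
quantifier shape — are in the companion `BGM2006Sec3FlowLemmas.lean`: `hyp236_of_bound32` ((2.36) from
(3.2) via (3.3)), `bound365_of_flow` (the arithmetic (3.66)+(3.69) ⟹ (3.70), i.e. (2.71a) on all scales
`h_β ≤ j ≤ 0` under `|j||U| ≤ c₀` — the tree's `abs_le_of_conditional_increments` in this vocabulary),
`hyp236_downward` / `hyp236_and_bound365_all` (the induction skeleton of §3: Theorem 3.1 + the §3.2 claim at
common constants ⟹ (2.36) and (2.71a) at every scale).

## Reading of the hypothesis "E_j satisfies (2.36) for any j ≥ h" (Theorem 3.1, Lemma 2.5, Theorem 2.1)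

(2.36) is displayed with the letter `h` and bounds the increment `E_h − E_{h−1}` (p0008:L54); `Hyp236 D C j`
below is that display with `h := j`. The conclusion (3.2) of Theorem 3.1 at scale `h` is the weighted-`L¹`
form of the SAME increment (via (3.3), p0019:L84–97: "the bound (2.36) easily follows from Theorem (3.1)").
The printed hypothesis "E_j(k) satisfies (2.36) for any j ≥ h" therefore bears on the previously constructed
dispersions `E_0, …, E_h`, i.e. on `Hyp236` at the indices `j = h+1, …, 0` — the reading under which the
induction of §3.1 is not circular and which §3.2 prints verbatim ("if, given h ≤ 0, for any j > h (2.36) is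
satisfied", p0033:L72). We type `∀ j, h < j → j ≤ 0 → Hyp236 D C j` and record the printed wording here;
typing `h ≤ j` literally would put the sup-norm form of the conclusion among the hypotheses (referee: rule).

## Vacuity / degenerate-endpoint note

The printed right-hand sides of (2.36), (3.2), (3.23) carry the factor `|h|`, which VANISHES at `h = 0`
although the scale-0 increment `E_{−1} − E_0 = C_0⁻¹ n̂_0` is `O(U) ≠ 0` ((2.23), (2.16) with `l = 1`) and the
scale-0 four-sector count is `≥ 1`: the displays are used for `h ≤ −1` (equivalently `|h|` read as
`max{1,|h|}`); the tree's sector count `count_pairs_exists` has the `h = 0`-safe form `K(J+2+log N)/w`. We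
type `|h|` as printed (`|(h : ℝ)|`); consumers instantiate at `h ≤ −1` or absorb the endpoint in `C`.

## Lemma 3.1 (sector counting) — TREE, cited not restated (row BGM06.L3.1, DECOMP F.0)

Lemma 3.1 (p0023:L20–26, proof App. A2): for `h_β ≤ h ≤ 0`,
`sup_{ω̄₁ ∈ Ō_h} Σ_{ω̄₂,ω̄₃,ω̄₄ ∈ Ō_h} χ({ω̄₁,ω̄₂,ω̄₃,ω̄₄}) ≤ c γ^{−h} |h|` (3.23) (ISOTROPIC sectors of angular
width `πγ^h`, `χ` = "there are momenta in the four s-sectors summing to zero", App. A2 p0035:L114–128), whence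
(3.24) `Σ_{ω̄₁,…,ω̄₄} χ ≤ c γ^{−2h}|h|`. BOTH factors `γ^{−h}` and `|h|` are load-bearing (K1's why-might-fail).
The tree PROVES the counting scheme of App. A2 for the free band Fermi curve at every level `μ` in a
compact of `(−4, 0)` (tree convention): `Literature.MathematicalPhysics.QuantumLattice.count_pairs_exists`
(module `HubbardBandSectorCountingCounts`): `#{(a,c) : |h_μ(θ₁; θ_a, θ_c)| ≤ C_δ w} ≤ K_p (J + 2 + log N)/w`
on every grid `N w = 2π`, `2^J w = π`, uniformly in `θ₁` and `μ` — with `w = πγ^h` (`N = 2γ^{−h}`,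
`J = −2h − 1`… i.e. `J + 2 + log N = O(1 + |h| log γ)`) this is `≤ K' γ^{−h}(1 + |h|)`, the printed
`cγ^{−h}|h|` in its `h = 0`-safe form; constants: print `c` (unspecified `O(1)`), tree `K_p` explicit in the
band bounds `B : BandBounds a b`. NOT covered by the tree theorem (reported as a GAP candidate on STATUS):
(3.23) is stated for the sectors of the INTERACTING scale-`h` Fermi curve `p_F^{(h)}` of `ε_h` (App. A2
uses `p_F^{(h)}`, (A2.6)–(A2.7)), whereas `count_pairs_exists` counts on the free band curve `ε_0 = μ`
(the level function `hfun`); and the tree counts PAIRS `(ω̄₂, ω̄₃)` at tolerance `C_δ w` (the fourth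
sector then ranges over `≤ 8` choices, (A2.5)/(A2.14) — `card_prod3_le` in the toolbox). The sector /
constraint-function vocabulary (`χ`, `≺`, `S_{h,ω}`) is typed in the companion file `BGM2006AppA`.

**Remark p0027:L21 (row BGM06.R3.1)**: "after a suitable (and obvious) identification of the symbols in
(3.30a) with those in (3.43), … the bound (3.31) and the analogue bound for [v*] in item (A2.3) are
essentially the same as (3.43)" — proof-internal bookkeeping of §3.1 cases (A)/(B); docstring only.
-/

noncomputable section

open Finset

namespace Literature.MathematicalPhysics.QuantumLattice.FermiRG

namespace BGM2006Sec3

/-! ### Scale-indexed data of the multiscale construction (what the displays of §3 bound) -/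

/-- **The scale-indexed numerical data of BGM's multiscale integration entering §3.** Intended
instance: the 2D Hubbard model of BGM Thm 1.1 at chemical potential `μ`, coupling `U` with `|U| ≤ U₀`,
inverse temperature `β` (infrared scale `h_β`, (2.31a)), side `L` (bounds uniform in `L`, footnote p0008:L60),
scaling parameter `γ = 4` ((2.9)); scales are `h_β ≤ h ≤ 0`. Each field is the supremum / weighted `L¹` norm
that the cited display bounds; `∫dx = ∫_{−β/2}^{β/2} dx₀ Σ_{x⃗}` ((2.7)). This structure has no
propositional fields: it carries data only; the printed bounds are the predicates below.
[cite: BenfattoGiulianiMastropietro2006, §3 p0019:L49] -/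
structure ScaleData where
  /-- the scaling parameter `γ` (`= 4` in print, (2.9) p0006) -/
  γ : ℝ
  /-- the coupling `U` of (1.1) -/
  U : ℝ
  /-- the bound `U₀` on `|U|` (Thm 1.1; the device "`U₀|h_β| = c₀` small enough") -/
  U₀ : ℝ
  /-- the infrared (temperature) scale `h_β ≤ 0` of (2.31a) p0007 ("finite and actually larger than
  `[log_γ(π/(2e₀β))]`") -/
  hβ : ℤ
  /-- `dE h n = sup_k max_{i₁,…,iₙ ∈ {0,1,2}} |∂_{k_{i₁}} ⋯ ∂_{k_{iₙ}} (E_h(k) − E_{h−1}(k))|` (discrete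
  derivatives (2.36aa)), `n = 0`: no derivative; the left-hand sides of (2.36) p0008:L54 at scale `h`,
  `k` ranging over the support of `C_h⁻¹` -/
  dE : ℤ → ℕ → ℝ
  /-- `betaL1 h n = sup_{ω̄ ∈ Ō_h} ∫dx |x|ⁿ |β²_{h,ω̄}(x)|`, `β²_{h,ω̄} = 𝔉̄_{2,h,(ω̄,ω̄)} * β²_h` the isotropic
  sectorisation (3.1) p0019:L62 of the Fourier transform `β²_h` of `β̂²_h(k) = E_{h−1}(k) − E_h(k)` ((2.34));
  the left-hand sides of (3.2) -/
  betaL1 : ℤ → ℕ → ℝ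
  /-- `lamL1 j = sup_{Ω₄ = {ω_f ∈ O_j}} sup_{x₁} ∫dx₂dx₃dx₄ |λ̃_{j,Ω₄}(x₁,x₂,x₃,x₄)|`, the left-hand side of
  (3.65) p0033:L89 (`λ̃_{j,Ω}` the sector-modified running coupling function (2.71); by translation invariance
  this equals `(L²β)⁻¹ ∫dx_v |λ̃_{j,Ω}(x_v)|`, the left-hand side of (2.71a) p0014) -/
  lamL1 : ℤ → ℝ
  /-- `lamL1b j` = the same norm of the modified coupling functions `λ̃_{j,Ω̃_{v,ω̄}}` with MIXED
  isotropic/anisotropic sector labels (3.15), the left-hand side of (2.71b) p0022:L21 -/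
  lamL1b : ℤ → ℝ
  /-- `lam0L1 j` = the same norm of the first term `𝔉_{4,j,Ω₄} * λ₀` of the beta-function equation (3.66)
  p0033:L100 (`λ₀` the scale-0 quartic kernel) -/
  lam0L1 : ℤ → ℝ
  /-- `betaFnL1 j j'` = the same norm of `β⁴_{j',Ω₄} = 𝔉_{4,j,Ω₄} * β⁴_{j'}` (3.67) p0033:L103–p0034:L2, the
  scale-`j'` term (`j < j' ≤ 0`) of (3.66) sectorised at scale `j`; "|β⁴_{j',Ω₄}(x)| ≤ c|U|²" (p0034:L26)
  is read in this norm -/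
  betaFnL1 : ℤ → ℤ → ℝ
  /-- `loopVertex h' k j = sup Σ_{ω ∈ O_{h'}} ∫d(x₁−x₄) |x₁−x₄|ʲ |∫dx₂dx₃ g^{(h')}_ω(x₂−x₃)
  λ̃_{k,Ω̃₄}(x₁,x₂,x₃,x₄)|`, the left-hand side of (3.8) p0020:L26–33 (the sup over the data fixed there:
  `h ≤ h' ≤ k`, `ω̄₁, ω̄₄ ∈ Ō_k` with `|ω̄₁ − ω̄₄| ≤ 1`, `Ω̃₄` as after (3.8), `λ̃_{k,Ω̃₄}` of (3.8a)) -/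
  loopVertex : ℤ → ℤ → ℕ → ℝ

/-! ### The inductive hypotheses (2.36), (2.71a)/(3.65), (2.71b) and the `c₀` device, as predicates -/

/-- **(2.36) at scale `j`** (p0008:L54, row BGM06.E2.36 is t1's; restated at the norm level because §3 is
its inductive proof — TODO(dedup): bridge to `BGM2006Sec2Setup` once landed):
`|E_j(k) − E_{j−1}(k)| ≤ C₀|U||j|γ^{2j}` and, for `n ≥ 1`,
`|∂_{k_{i₁}}⋯∂_{k_{iₙ}}(E_j(k) − E_{j−1}(k))| ≤ Cₙ|U|²|j|γ^{(2−n)j}`. Constants `C : ℕ → ℝ` (`C 0 = C₀`).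
[cite: BenfattoGiulianiMastropietro2006, §2.3 (2.36) p0008:L54] -/
def Hyp236 (D : ScaleData) (C : ℕ → ℝ) (j : ℤ) : Prop :=
  D.dE j 0 ≤ C 0 * |D.U| * |(j : ℝ)| * D.γ ^ (2 * j) ∧
    ∀ n : ℕ, 1 ≤ n → D.dE j n ≤ C n * |D.U| ^ 2 * |(j : ℝ)| * D.γ ^ ((2 - (n : ℤ)) * j)

/-- **(3.65) at scale `j`**, i.e. the smallness condition (2.71a) for the modified running coupling
functions of scale `j` (p0033:L86–89: `∫dx₂dx₃dx₄ |λ̃_{j,Ω₄}(x)| ≤ C|U|`, "implying (2.71a)").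
[cite: BenfattoGiulianiMastropietro2006, §3.2 (3.65) p0033:L89] -/
def Bound365 (D : ScaleData) (Cl : ℝ) (j : ℤ) : Prop :=
  D.lamL1 j ≤ Cl * |D.U|

/-- **(2.71b) at scale `j`** (p0022:L21–23): `(L²β)⁻¹ ∫dx_v |λ̃_{h_v−1,Ω̃_{v,ω̄}}(x_v)| ≤ C|U|` for the
modified coupling functions with mixed isotropic/anisotropic labels (3.15), "essentially equivalent to the
smallness condition (2.71a)". [cite: BenfattoGiulianiMastropietro2006, §3.1 (2.71b) p0022:L23] -/
def Bound271b (D : ScaleData) (Cl : ℝ) (j : ℤ) : Prop :=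
  D.lamL1b j ≤ Cl * |D.U|

/-- **The `c₀` device** "if `U₀|h_β| = c₀` is small enough" (Theorem 3.1 p0019:L78, Lemma 2.5 p0017:L108,
(3.70) "we used that `|j||U| ≤ c₀`"), typed as `|U| ≤ U₀` and `U₀·|h_β| ≤ c₀` with the threshold `c₀` a
PARAMETER: this is the hypothesis `β⁻¹ ≥ e^{−a/|U|}` of Thm 1.1 (tree: `log_div_log_mul_le_iff` in
`RunningCouplingFlow`), the one the KL programme must remove (DECOMP App. D). [cite: BenfattoGiulianiMastropietro2006, §3.1 Thm 3.1 p0019:L78] -/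
def SmallC0 (D : ScaleData) (c₀ : ℝ) : Prop := |D.U| ≤ D.U₀ ∧ D.U₀ * |(D.hβ : ℝ)| ≤ c₀

/-! ### §3.1: Theorem 3.1 — the bounds (3.2) on the sectorised dispersion increment (FACT-LIST F-009) -/

/-- **(3.2) at scale `h`** (p0019:L78–80): `∫dx |β²_{h,ω̄}(x)| ≤ C₀|U||h|γ^{2h}` and, for `n ≥ 1`,
`∫dx |x|ⁿ |β²_{h,ω̄}(x)| ≤ Cₙ|U|²|h|γ^{(2−n)h}`, uniformly in `ω̄ ∈ Ō_h` (the data field is the sup).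
Same constants `C` as in (2.36). [cite: BenfattoGiulianiMastropietro2006, §3.1 (3.2) p0019:L80] -/
def Bound32 (D : ScaleData) (C : ℕ → ℝ) (h : ℤ) : Prop :=
  D.betaL1 h 0 ≤ C 0 * |D.U| * |(h : ℝ)| * D.γ ^ (2 * h) ∧
    ∀ n : ℕ, 1 ≤ n → D.betaL1 h n ≤ C n * |D.U| ^ 2 * |(h : ℝ)| * D.γ ^ ((2 - (n : ℤ)) * h)

/-- **Theorem 3.1** (p0019:L72–81; FACT-LIST F-009, row BGM06.T3.1; DECOMP U1). *"Given `h_β ≤ h ≤ 0`, let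
us assume that `E_j(k)` satisfies (2.36) for any `j ≥ h` and that, given any tree `τ ∈ 𝒯_{h,n}` (with all its
labels), `λ̃_{h_{v*}−1,Ω_{v*}}` satisfies (2.71a) for all the endpoints `v* ∈ τ`. Then, if `U₀|h_β| = c₀` is
small enough,"* (3.2) holds. Typed with the constants `C` (of (2.36)/(3.2)), `Cl` (of (2.71a)) and the
threshold `c₀` as parameters (print: the implication holds for some `c₀ > 0` depending on the `O(1)`
constants); the endpoint hypothesis is (2.71a) = `Bound365` at all scales `h ≤ j ≤ 0` (endpoints have
`h_{v*} − 1 ≥ h`); the dispersion hypothesis is `Hyp236` at the indices `h < j ≤ 0` (see the module doc,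
"Reading of the hypothesis"). BGM PROVE this for the data of the 2D Hubbard model at `0 < μ_BGM < (2−√2)/2`;
here it is a predicate, to be ASSUMED for that instance. The arithmetic skeleton (3.66)–(3.70) of the
companion induction is the tree's `runningCoupling_abs_le`. [cite: BenfattoGiulianiMastropietro2006, Thm 3.1 p0019:L72] -/
def Theorem31 (D : ScaleData) (C : ℕ → ℝ) (Cl c₀ : ℝ) : Prop :=
  SmallC0 D c₀ →
    ∀ h : ℤ, D.hβ ≤ h → h ≤ 0 →
      (∀ j : ℤ, h < j → j ≤ 0 → Hyp236 D C j) →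
        (∀ j : ℤ, h ≤ j → j ≤ 0 → Bound365 D Cl j) →
          Bound32 D C h

/-- **(3.3)** (p0019:L84–97): for `k` in the support of `C_h⁻¹`, `E_{h−1}(k) − E_h(k) = ∫dx e^{ikx} β²_{h,ω̄(k)}(x)`
and `∂_{k_{i₁}}⋯∂_{k_{iₙ}}(E_{h−1} − E_h)(k) = iⁿ ∫dx x_{i₁}⋯x_{iₙ} e^{ikx} β²_{h,ω̄(k)}(x)`, "hence they can be
bounded by the l.h.s. of (3.2)": at the norm level, `dE h n ≤ betaL1 h n`. A predicate on the abstract data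
(it HOLDS for the BGM instance by `|∫ e^{ikx} xⁿ β| ≤ ∫ |x|ⁿ|β|`; typed, not asserted).
[cite: BenfattoGiulianiMastropietro2006, §3.1 (3.3) p0019:L95] -/
def Link33 (D : ScaleData) : Prop :=
  ∀ (h : ℤ) (n : ℕ), D.dE h n ≤ D.betaL1 h n

/-! ### §3.1: the labelled-tree profile and the improved two-leg bounds (3.6), (3.7), the loop vertex bound (3.8) -/

/-- **The combinatorial profile of a labelled tree** `(τ ∈ 𝒯_{h,n}, P ∈ 𝒫_τ, T ∈ 𝐓)` entering the
right-hand sides of (2.77), (2.98), (3.6), (3.69): the order `n`, the root scale `h`, the number `|P_{v₀}|`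
of external legs, and over a finite family `V` of vertices (the non-endpoint vertices for (2.77)/(2.98); the
`c`-vertices `V_c` — endpoints and vertices with internal lines, p0016:L44 — for (3.6)/(3.69)) the numbers
`|P_v|` (legs), `s_v` (branches), the scale `h_v` and the scale `h_{v'}` of the vertex (`c`-vertex)
immediately preceding `v`. Vertices are named by naturals. §2.6 of the source (t1's file) is the home of the
trees themselves. [cite: BenfattoGiulianiMastropietro2006, §2.6 p0012:L46] -/
structure LabelledTree where
  /-- the order `n` (number of endpoints) -/
  n : ℕ
  /-- the root scale `h` (`τ ∈ 𝒯_{h,n}`) -/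
  h : ℤ
  /-- `|P_{v₀}|`, the number of external legs -/
  rootLegs : ℕ
  /-- the vertices over which the product is taken -/
  V : Finset ℕ
  /-- `|P_v|` -/
  legs : ℕ → ℕ
  /-- `s_v`, the number of lines branching from `v` -/
  branches : ℕ → ℕ
  /-- `h_v` -/
  scale : ℕ → ℤ
  /-- `h_{v'}`, `v'` the vertex immediately preceding `v` -/
  predScale : ℕ → ℤ

/-- **The scaling dimension `δ(p) = 1 − p/4 + 𝟙(p ≥ 10)`** of (2.78) p0015:L73 (row BGM06.T2.1 is t1's; restated
because (3.6)/(3.69) use it — TODO(dedup): import from `BGM2006Sec2Expansion` once landed).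
[cite: BenfattoGiulianiMastropietro2006, §2.8 (2.78) p0015:L73] -/
def scalingDim (p : ℕ) : ℝ :=
  1 - (p : ℝ) / 4 + if 10 ≤ p then 1 else 0

/-- **The vertex product of (3.6)** (p0019:L138): `Π_{v ∈ V_c} (1/s_v!) |P_v|⁵ γ^{δ(|P_v|)(h_v − h_{v'})}`.
[cite: BenfattoGiulianiMastropietro2006, §3.1 (3.6) p0019:L138] -/
def prodVc5 (γ : ℝ) (T : LabelledTree) : ℝ :=
  ∏ v ∈ T.V, (1 / ((T.branches v).factorial : ℝ)) * (T.legs v : ℝ) ^ 5 *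
    γ ^ (scalingDim (T.legs v) * ((T.scale v - T.predScale v : ℤ) : ℝ))

/-- **The vertex product of (3.69)** (p0034:L23): `Π_{v ∈ V_c} (1/s_v!) γ^{δ(|P_v|)(h_v − h_{v'})}`.
[cite: BenfattoGiulianiMastropietro2006, §3.2 (3.69) p0034:L23] -/
def prodVc (γ : ℝ) (T : LabelledTree) : ℝ :=
  ∏ v ∈ T.V, (1 / ((T.branches v).factorial : ℝ)) *
    γ ^ (scalingDim (T.legs v) * ((T.scale v - T.predScale v : ℤ) : ℝ))

/-- **(3.6)–(3.7), the improved two-leg bound** (p0019:L132–138, p0020:L5–17), as a predicate on a family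
`𝒯` of labelled trees with `|P_{v₀}| = 2` (index `i` = the labelled tree `(τ, P, T)`) and the values
`J i j = sup_{ω̄ ∈ Ō_h} J̄⁽²⁾_{h,n,ω̄}(τ,P,T; j)` of (3.5): for `n ≥ 2`,
`J̄⁽²⁾ ≤ (c_j|U|)ⁿ |h| γ^{(2−j)h} Π_{v∈V_c} (1/s_v!)|P_v|⁵ γ^{δ(|P_v|)(h_v−h_{v'})}` (3.6), and for `n = 1`
(3.7): `J̄⁽²⁾ ≤ c_j |U|^{2−δ_{j,0}} |h|^{δ_{j,0}} γ^{(2−j)h}`. "An improved version of the bound (2.77), valid if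
`|P_{v₀}| = 2`" — §3.1 proves it under (2.71a), (2.71b), (3.8) (p0033:L66–69).
[cite: BenfattoGiulianiMastropietro2006, §3.1 (3.6)-(3.7) p0019:L138] -/
def Bound36 {ι : Type*} (γ U : ℝ) (c : ℕ → ℝ) (𝒯 : ι → LabelledTree) (J : ι → ℕ → ℝ) : Prop :=
  ∀ (i : ι) (j : ℕ), (𝒯 i).rootLegs = 2 →
    (2 ≤ (𝒯 i).n →
      J i j ≤ (c j * |U|) ^ (𝒯 i).n * |((𝒯 i).h : ℝ)| * γ ^ ((2 - (j : ℤ)) * (𝒯 i).h) * prodVc5 γ (𝒯 i)) ∧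
    ((𝒯 i).n = 1 →
      J i j ≤ c j * |U| ^ (2 - if j = 0 then 1 else 0) * |((𝒯 i).h : ℝ)| ^ (if j = 0 then 1 else 0) *
        γ ^ ((2 - (j : ℤ)) * (𝒯 i).h))

/-- **(3.8), the loop-contracted vertex bound** (p0020:L22–33; DECOMP U5′): for `h ≤ h' ≤ k ≤ 0`,
`Σ_{ω∈O_{h'}} ∫d(x₁−x₄) |x₁−x₄|ʲ |∫dx₂dx₃ g^{(h')}_ω(x₂−x₃) λ̃_{k,Ω̃₄}(x₁,x₂,x₃,x₄)|
 ≤ c_j |U|^{2−δ_{j,0}} (1 + |k|^{δ_{j,0}}) γ^{2h'−jk}` (typed literally: for `j ≥ 1` the factor is `1 + |k|⁰ = 2`).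
[cite: BenfattoGiulianiMastropietro2006, §3.1 (3.8) p0020:L33] -/
def Bound38 (D : ScaleData) (c : ℕ → ℝ) (h' k : ℤ) (j : ℕ) : Prop :=
  D.loopVertex h' k j ≤
    c j * |D.U| ^ (2 - if j = 0 then 1 else 0) * (1 + |(k : ℝ)| ^ (if j = 0 then 1 else 0)) *
      D.γ ^ (2 * h' - (j : ℤ) * k)

/-! ### §3.2: the flow of the quartic couplings (3.65)–(3.70) and the bounds (3.71)–(3.77) (row BGM06.S3.2; DECOMP U4, U5) -/

/-- **(3.66) at the norm level** (p0033:L97–103): the beta-function equation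
`λ̃_{j,Ω₄} = 𝔉_{4,j,Ω₄} * λ₀ + Σ_{j'=j+1}^{0} 𝔉_{4,j,Ω₄} * β⁴_{j'}` gives, by the triangle inequality,
`lamL1 j ≤ lam0L1 j + Σ_{j < j' ≤ 0} betaFnL1 j j'`. (The identity itself lives on the kernels; this is the
consequence (3.70) uses; cf. the hypothesis `hlam` of the tree's `abs_le_of_conditional_increments`.)
[cite: BenfattoGiulianiMastropietro2006, §3.2 (3.66) p0033:L103] -/
def FlowSplit366 (D : ScaleData) : Prop :=
  ∀ j : ℤ, D.hβ ≤ j → j ≤ 0 → D.lamL1 j ≤ D.lam0L1 j + ∑ j' ∈ Finset.Ioc j 0, D.betaFnL1 j j'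

/-- The first term of (3.66): `𝔉_{4,j,Ω₄} * λ₀` has norm `≤ C₀|U|` ("for `h = 0` the bound just follows from the
bounds on the kernels of the effective potential `𝒱⁽⁰⁾`", p0033:L91; the `C₀|U|` of (3.70)).
[cite: BenfattoGiulianiMastropietro2006, §3.2 (3.70) p0034:L28] -/
def Lam0Bound (D : ScaleData) (C₀ : ℝ) : Prop :=
  ∀ j : ℤ, D.hβ ≤ j → j ≤ 0 → D.lam0L1 j ≤ C₀ * |D.U|

/-- **(3.69)** (p0034:L18–23), as a predicate on a family of labelled trees with `|P_{v₀}| = 4`, `n ≥ 2`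
("by construction there is no trivial tree contributing to `β⁴_{j'}`", p0034:L4) and the values
`J4 i = J̄⁽⁴⁾_{j',n,Ω₄}(τ,P,T)` of (3.68): `J̄⁽⁴⁾ ≤ (C|U|)ⁿ Π_{v∈V_c} (1/s_v!) γ^{δ(|P_v|)(h_v−h_{v'})}` —
obtained "assuming inductively the bound (3.65) for `j' > j` and repeating the proof of Lemma (2.5)".
[cite: BenfattoGiulianiMastropietro2006, §3.2 (3.69) p0034:L23] -/
def Bound369 {ι : Type*} (γ U C : ℝ) (𝒯 : ι → LabelledTree) (J4 : ι → ℝ) : Prop :=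
  ∀ i : ι, (𝒯 i).rootLegs = 4 → 2 ≤ (𝒯 i).n → J4 i ≤ (C * |U|) ^ (𝒯 i).n * prodVc γ (𝒯 i)

/-- **"|β⁴_{j',Ω₄}(x)| ≤ c|U|²"** (p0034:L25–26), the consequence of (3.69) summed over trees, in its CONDITIONAL
form: the scale-`j'` increment is bounded by `c|U|²` provided the smallness (3.65) holds at all scales
`j' ≤ j'' ≤ 0` (the inductive assumption under which (3.69) is derived).
[cite: BenfattoGiulianiMastropietro2006, §3.2 (3.69)-(3.70) p0034:L26] -/
def BetaFnBound (D : ScaleData) (Cl c : ℝ) : Prop :=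
  ∀ j j' : ℤ, D.hβ ≤ j → j < j' → j' ≤ 0 →
    (∀ j'' : ℤ, j' ≤ j'' → j'' ≤ 0 → Bound365 D Cl j'') → D.betaFnL1 j j' ≤ c * |D.U| ^ 2

/-- **(3.71)** (p0034:L36–43), the base case `k = 0` of (3.8) with `j = 0`: `loopVertex h' 0 0 ≤ C₀|U|γ^{2h'}` for
`h ≤ h' ≤ 0` (by (3.72)–(3.73): Lemma 2.2b for the `g^{(h')}_ω(0)` term, `C₀'|U|²γ^{−h'}γ^{3h'}` for the remainder).
[cite: BenfattoGiulianiMastropietro2006, §3.2 (3.71) p0034:L43] -/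
def Bound371 (D : ScaleData) (C₀ : ℝ) (h' : ℤ) : Prop :=
  D.loopVertex h' 0 0 ≤ C₀ * |D.U| * D.γ ^ (2 * h')

/-- **(3.75)–(3.77)** (p0034:L85–128), the inductive step for (3.8): the `k`-th beta-function term contributes
`≤ c|U|²γ^{2h'}|k|` (3.75), summing to `C₀|U|γ^{2h'} + c|U|²γ^{2h'} Σ_{k̄<k≤0}|k| ≤ C|U|γ^{2h'}|k̄|` (3.76) using
`|U||k| ≤ c₀`, and for `j ≥ 1` `C_{0,j}|U|²γ^{2h'} + c_j|U|²γ^{2h'}Σ_{k̄<k≤0}|k|γ^{−jk} ≤ C_j|U|²|k̄|γ^{2h'−jk̄}` (3.77).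
Typed as the resulting claim of §3.2: (3.8) at every `h ≤ h' ≤ k ≤ 0`. Docstring-level aid rows E3.74.
[cite: BenfattoGiulianiMastropietro2006, §3.2 (3.74)-(3.77) p0034:L80] -/
def Bound38All (D : ScaleData) (c : ℕ → ℝ) (h : ℤ) : Prop :=
  ∀ (h' k : ℤ) (j : ℕ), h ≤ h' → h' ≤ k → k ≤ 0 → Bound38 D c h' k j

/-- **The claim of §3.2** (p0033:L72–80, row BGM06.S3.2, DECOMP U4/U5): *"if, given `h ≤ 0`, for any `j > h`
(2.36) is satisfied, then (2.71a) and (2.71b) are true for `h_i − 1 ≥ h` and (3.8) is true for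
`h ≤ k' ≤ k ≤ 0`"* (under the standing device `U₀|h_β| = c₀` small, (3.65) p0033:L86). Typed as a predicate
with explicit constants; NOT a FACT-LIST licence of its own (S3.2 is a DEF row) — it is the §3.2 half of the
induction whose §3.1 half is `Theorem31`; together with Theorem 2.1 and §2.9 it "completes the proof of
Theorem 1.1" (p0033:L77–80). [cite: BenfattoGiulianiMastropietro2006, §3.2 p0033:L72] -/
def Sec32Claim (D : ScaleData) (C : ℕ → ℝ) (Cl : ℝ) (c38 : ℕ → ℝ) (c₀ : ℝ) : Prop :=
  SmallC0 D c₀ →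
    ∀ h : ℤ, D.hβ ≤ h → h ≤ 0 →
      (∀ j : ℤ, h < j → j ≤ 0 → Hyp236 D C j) →
        (∀ j : ℤ, h ≤ j → j ≤ 0 → Bound365 D Cl j ∧ Bound271b D Cl j) ∧ Bound38All D c38 h

end BGM2006Sec3

end Literature.MathematicalPhysics.QuantumLattice.FermiRG
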